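import Literature.NumberTheory.EllipticCurves.EisensteinSeriesTwoCharacterWeightTwo
import Literature.NumberTheory.EllipticCurves.EisensteinSeriesTwoCharacterQExpansion
import Literature.NumberTheory.EllipticCurves.WeierstrassPDivisionCharacterQExpansion
import HarnessLib

/-!
# The `q`-expansion of the weight-`2` two-character series `S_2^{ψ,φ}`

Topic `Literature/NumberTheory/EllipticCurves`; namespace
`Literature.NumberTheory.EllipticCurves.ModularForms`.  THEOREMS and one auxiliary definition
(`tcLift`); no named fact.

For `ψ ≠ 1` modulo `u` (so `u > 1`) and `φ` modulo `v`, the combination of `℘`-division values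
`S_2^{ψ,φ} = ∑_{c₁,d₀} ψ(c₁) φ̄(d₀) f_{(vc₁,d₀)}` of `EisensteinSeriesTwoCharacterWeightTwo` is
`(uv)²` times the Eisenstein-summed lattice series of weight `2`:

* `twoCharTwo_eq_tsum_rows` — `S(τ) = (uv)² ∑_{c ∈ ℤ} ψ(c) ∑_{d ∈ ℤ} φ̄(d) (vcτ + d)^{-2}`
  (the level-one parts `-∑_x (x₀τ+x₁)^{-2}` of the `f_v` cancel as `∑ ψ(c₁) = 0`; regrouping by
  residues exactly as in `WeierstrassPDivisionCharacterQExpansion`);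
* `twoCharTwo_eq_qExpansion` — for `φ` primitive and `ψ(-1)φ(-1) = 1`:
  `S(τ) = (uv)² · 2 (-2πi)² W(φ̄) v⁻² ∑_{n ≥ 1} σ_1^{ψ,φ}(n) qⁿ`,
  `σ_1^{ψ,φ}(n) = ∑_{d ∣ n} ψ(n/d) φ(d) d` (rows `m > 0` by `charRowTwo_pos`, the row `m = 0`
  vanishes as `ψ(0) = 0`, row symmetry by `weightedRow_neg`); Diamond–Shurman Thm. 4.6.2;
* `qExpansion_coeff_twoCharTwoMF` — the coefficients of the modular form: `a₀ = 0`,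
  `aₙ = twoCharTwoConst u φ · σ_1^{ψ,φ}(n)`.

## References

* F. Diamond, J. Shurman, *A First Course in Modular Forms*, GTM 228 (2005), §4.6 (Thm. 4.6.2),
  §4.8. [DiamondShurman2005]
* T. Miyake, *Modular Forms*, Springer (2006), Thm. 7.1.3, Thm. 7.2.12. [Miyake2006]
-/

noncomputable section

open UpperHalfPlane EisensteinSeries Complex Filter Finset

open scoped Real MatrixGroups

namespace Literature.NumberTheory.EllipticCurves.ModularForms

section Regroup

variable {u v : ℕ} [NeZero u] [NeZero v] (ψ : DirichletCharacter ℂ u) (φ : DirichletCharacter ℂ v)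
  (τ : ℍ)

/-- The integer representative `(v c̃₁, d̃₀)` of the index vector `(vc₁, d₀)`. [folklore] -/
def tcLift (c₁ : ZMod u) (d₀ : ZMod (u * v)) : Fin 2 → ℤ := ![((v * c₁.val : ℕ) : ℤ), (d₀.val : ℤ)]

/-- `f_{(vc₁,d₀)} = weierstrassPDiv (uv) (v c̃₁, d̃₀)`. [folklore] -/
theorem pdivZ_tcVec (c₁ : ZMod u) (d₀ : ZMod (u * v)) :
    pdivZ (u * v) (tcVec c₁ d₀) = weierstrassPDiv (u * v) (tcLift c₁ d₀) := by
  refine pdivZ_eq_of_intCast (u * v) _ _ fun i ↦ ?_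
  fin_cases i
  · simp [tcLift, tcVec, vMul]
  · simp [tcLift, tcVec]

/-- `∑_{c₁,d₀} ψ(c₁) φ̄(d₀) = 0` for `ψ ≠ 1`. [folklore] -/
theorem sum_tcWeight_eq_zero (hψ1 : ψ ≠ 1) :
    ∑ c₁ : ZMod u, ∑ d₀ : ZMod (u * v), tcWeight ψ φ c₁ d₀ = 0 := by
  simp only [tcWeight, ← Finset.mul_sum, ← Finset.sum_mul, MulChar.sum_eq_zero_of_ne_one hψ1,
    zero_mul]

/-- The character combination of the lattice summands of the `f_{(vc₁,d₀)}`: the level-one part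
cancels (`ψ ≠ 1`). [folklore] -/
theorem sum_tcWeight_mul_summand (hψ1 : ψ ≠ 1) (x : Fin 2 → ℤ) :
    ∑ c₁ : ZMod u, ∑ d₀ : ZMod (u * v), tcWeight ψ φ c₁ d₀ *
        (((u * v : ℕ) : ℂ) ^ 2 * eisSummand 2 (tcLift c₁ d₀ - ((u * v : ℕ) : ℤ) • x) τ -
          eisSummand 2 x τ) =
      ((u * v : ℕ) : ℂ) ^ 2 * ∑ c₁ : ZMod u, ∑ d₀ : ZMod (u * v), tcWeight ψ φ c₁ d₀ *
        eisSummand 2 (tcLift c₁ d₀ - ((u * v : ℕ) : ℤ) • x) τ := by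
  have h0 := sum_tcWeight_eq_zero ψ φ hψ1
  simp_rw [mul_sub, Finset.sum_sub_distrib, ← Finset.sum_mul, h0, zero_mul, sub_zero,
    Finset.mul_sum]
  refine Finset.sum_congr rfl fun c₁ _ ↦ Finset.sum_congr rfl fun d₀ _ ↦ ?_
  ring

/-- The regrouped summand at `x = (-a, -b)`:
`(v(au + c̃₁)τ + (b(uv) + d̃₀))^{-2}`. [folklore] -/
theorem eisSummand_tcLift_neg (c₁ : ZMod u) (d₀ : ZMod (u * v)) (a b : ℤ) :
    eisSummand 2 (tcLift c₁ d₀ - ((u * v : ℕ) : ℤ) • ![-a, -b]) τ =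
      ((v : ℂ) * ((a * u + (c₁.val : ℤ) : ℤ) : ℂ) * τ +
        ((b * (u * v : ℕ) + (d₀.val : ℤ) : ℤ) : ℂ)) ^ (-(2 : ℤ)) := by
  rw [eisSummand]
  have h0 : ((tcLift c₁ d₀ - ((u * v : ℕ) : ℤ) • ![-a, -b]) 0 : ℤ) = v * (a * u + (c₁.val : ℤ)) := by
    simp [tcLift]; ring
  have h1 : ((tcLift c₁ d₀ - ((u * v : ℕ) : ℤ) • ![-a, -b]) 1 : ℤ) = b * (u * v : ℕ) + d₀.val := by
    simp [tcLift]; ring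
  rw [h0, h1]
  push_cast
  ring_nf

/-- The regrouped family on `ℤ × ℤ` is summable (transport of the summability of the lattice sums
of the `f_{(vc₁,d₀)}`; `ψ ≠ 1`). [folklore] -/
theorem summable_sum_tcWeight_zpow (hψ1 : ψ ≠ 1) :
    Summable fun p : ℤ × ℤ ↦ ∑ c₁ : ZMod u, ∑ d₀ : ZMod (u * v), tcWeight ψ φ c₁ d₀ *
      ((v : ℂ) * ((p.1 * u + (c₁.val : ℤ) : ℤ) : ℂ) * τ +
        ((p.2 * (u * v : ℕ) + (d₀.val : ℤ) : ℤ) : ℂ)) ^ (-(2 : ℤ)) := by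
  haveI : NeZero (u * v) := ⟨mul_ne_zero (NeZero.ne u) (NeZero.ne v)⟩
  have hN0 : ((u * v : ℕ) : ℂ) ≠ 0 := by exact_mod_cast NeZero.ne (u * v)
  have hS : Summable fun x : Fin 2 → ℤ ↦ ∑ c₁ : ZMod u, ∑ d₀ : ZMod (u * v), tcWeight ψ φ c₁ d₀ *
      (((u * v : ℕ) : ℂ) ^ 2 * eisSummand 2 (tcLift c₁ d₀ - ((u * v : ℕ) : ℤ) • x) τ -
        eisSummand 2 x τ) :=
    summable_sum fun c₁ _ ↦ summable_sum fun d₀ _ ↦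
      (summable_weierstrassPDiv (NeZero.ne (u * v)) (tcLift c₁ d₀) τ).mul_left _
  have hG : Summable fun x : Fin 2 → ℤ ↦ ∑ c₁ : ZMod u, ∑ d₀ : ZMod (u * v), tcWeight ψ φ c₁ d₀ *
      eisSummand 2 (tcLift c₁ d₀ - ((u * v : ℕ) : ℤ) • x) τ := by
    refine (hS.mul_left ((((u * v : ℕ) : ℂ) ^ 2)⁻¹)).congr fun x ↦ ?_
    rw [sum_tcWeight_mul_summand ψ φ τ hψ1 x, ← mul_assoc, inv_mul_cancel₀ (pow_ne_zero _ hN0),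
      one_mul]
  have h2 := (finTwoArrowEquiv ℤ).symm.summable_iff.mpr hG
  have h3 := (Equiv.neg (ℤ × ℤ)).summable_iff.mpr h2
  refine h3.congr fun p ↦ ?_
  simp only [Function.comp_apply, Equiv.neg_apply, finTwoArrowEquiv_symm_apply, Prod.fst_neg,
    Prod.snd_neg]
  refine Finset.sum_congr rfl fun c₁ _ ↦ Finset.sum_congr rfl fun d₀ _ ↦ ?_
  rw [eisSummand_tcLift_neg]

/-- **Residue regrouping of the inner sums**: for fixed `a`,
`∑_b ∑_{c₁,d₀} ψ(c₁) φ̄(d₀) (v(au+c̃₁)τ + (b uv + d̃₀))^{-2}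
   = ∑_{c₁} ψ(c₁) ∑_{d ∈ ℤ} φ̄(d) (v(au+c̃₁)τ + d)^{-2}`. [folklore] -/
theorem tsum_sum_tcWeight_zpow_row (a : ℤ) :
    ∑' b : ℤ, ∑ c₁ : ZMod u, ∑ d₀ : ZMod (u * v), tcWeight ψ φ c₁ d₀ *
        ((v : ℂ) * ((a * u + (c₁.val : ℤ) : ℤ) : ℂ) * τ +
          ((b * (u * v : ℕ) + (d₀.val : ℤ) : ℤ) : ℂ)) ^ (-(2 : ℤ)) =
      ∑ c₁ : ZMod u, ψ c₁ * ∑' d : ℤ, φ⁻¹ d *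
        ((v : ℂ) * ((a * u + (c₁.val : ℤ) : ℤ) : ℂ) * τ + d) ^ (-(2 : ℤ)) := by
  haveI : NeZero (u * v) := ⟨mul_ne_zero (NeZero.ne u) (NeZero.ne v)⟩
  have hN : ((u * v : ℕ) : ℤ) ≠ 0 := by exact_mod_cast NeZero.ne (u * v)
  have hF : ∀ c₁ : ZMod u, Summable fun d : ℤ ↦ φ⁻¹ d *
      ((v : ℂ) * ((a * u + (c₁.val : ℤ) : ℤ) : ℂ) * τ + d) ^ (-(2 : ℤ)) :=
    fun c₁ ↦ summable_charRowTwo φ⁻¹ τ _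
  have he : ∀ (c₁ : ZMod u) (d₀ : ZMod (u * v)), Summable fun b : ℤ ↦ tcWeight ψ φ c₁ d₀ *
      ((v : ℂ) * ((a * u + (c₁.val : ℤ) : ℤ) : ℂ) * τ +
        ((b * (u * v : ℕ) + (d₀.val : ℤ) : ℤ) : ℂ)) ^ (-(2 : ℤ)) := by
    intro c₁ d₀
    have h := ((hF c₁).comp_injective (i := fun b : ℤ ↦ b * (u * v : ℕ) + (d₀.val : ℤ))
      (fun b b' hbb' ↦ by simpa [NeZero.ne u, NeZero.ne v] using hbb')).mul_left (ψ c₁)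
    refine h.congr fun b ↦ ?_
    simp only [Function.comp_apply, tcWeight]
    have : ((((b * (u * v : ℕ) + (d₀.val : ℤ) : ℤ)) : ZMod v)) =
        ZMod.castHom (dvd_mul_left v u) (ZMod v) d₀ := by
      have h1 : ((((b * (u * v : ℕ) + (d₀.val : ℤ) : ℤ)) : ZMod (u * v))) = d₀ :=
        intCast_mul_add_val (u * v) b d₀
      have := congrArg (ZMod.castHom (dvd_mul_left v u) (ZMod v)) h1
      rwa [map_intCast] at this
    rw [this]
    ring
  rw [Summable.tsum_finsetSum fun c₁ _ ↦ summable_sum fun d₀ _ ↦ he c₁ d₀]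
  refine Finset.sum_congr rfl fun c₁ _ ↦ ?_
  rw [Summable.tsum_finsetSum fun d₀ _ ↦ he c₁ d₀, (tsum_int_eq_sum_zmod_tsum (u * v) (hF c₁)),
    Finset.mul_sum]
  refine Finset.sum_congr rfl fun d₀ _ ↦ ?_
  rw [← tsum_mul_left]
  refine tsum_congr fun b ↦ ?_
  simp only [tcWeight]
  have : ((((b * (u * v : ℕ) + (d₀.val : ℤ) : ℤ)) : ZMod v)) =
      ZMod.castHom (dvd_mul_left v u) (ZMod v) d₀ := by
    have h1 : ((((b * (u * v : ℕ) + (d₀.val : ℤ) : ℤ)) : ZMod (u * v))) = d₀ :=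
      intCast_mul_add_val (u * v) b d₀
    have := congrArg (ZMod.castHom (dvd_mul_left v u) (ZMod v)) h1
    rwa [map_intCast] at this
  rw [this]
  push_cast
  ring

omit [NeZero u] in
/-- **The weighted rows `c ↦ ψ(c) R_c` are summable** (`φ` primitive, `ψ(-1)φ(-1) = 1`): for
`c > 0` the row is `v⁻² (-2πi)² W(φ̄) ∑_n φ(n) n q^{cn} = O(|q|^c)`, and `ψ(-c) R_{-c} = ψ(c) R_c`.
[cite: DiamondShurman2005, §4.6] -/
theorem summable_weightedRowTwo (hφ : φ.IsPrimitive) (hpar : ψ (-1) * φ (-1) = 1) :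
    Summable fun c : ℤ ↦ ψ c * ∑' d : ℤ, φ⁻¹ d * ((v : ℂ) * c * τ + d) ^ (-(2 : ℤ)) := by
  have hφ' : φ⁻¹.IsPrimitive := Literature.NumberTheory.LFunctions.isPrimitive_inv φ hφ
  set q : ℂ := cexp (2 * π * Complex.I * τ) with hq_def
  have hq : ‖q‖ < 1 := norm_exp_two_pi_I_lt_one τ
  set K : ℂ := ((v : ℂ) ^ 2)⁻¹ * (-2 * π * Complex.I) ^ 2 * gaussSum φ⁻¹ (ZMod.stdAddChar (N := v))
    with hK
  -- the rows `c ≥ 1`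
  have hrow : ∀ c : ℕ, ψ ((c + 1 : ℕ) : ℤ) *
      ∑' d : ℤ, φ⁻¹ d * ((v : ℂ) * ((c + 1 : ℕ) : ℤ) * τ + d) ^ (-(2 : ℤ)) =
      K * (ψ ((c + 1 : ℕ) : ℤ) * ∑' n : ℕ, φ n * (n : ℂ) * (q ^ (c + 1)) ^ n) := by
    intro c
    have hpos : (0 : ℤ) < ((c + 1 : ℕ) : ℤ) := by exact_mod_cast Nat.succ_pos c
    rw [charRowTwo_pos φ⁻¹ τ hφ' hpos, inv_inv, hK]
    have : cexp (2 * π * Complex.I * (((c + 1 : ℕ) : ℤ) : ℂ) * τ) = q ^ (c + 1) := by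
      rw [hq_def, ← Complex.exp_nat_mul]; congr 1; push_cast; ring
    rw [this]; ring
  have hbound : ∀ c : ℕ, ‖ψ ((c + 1 : ℕ) : ℤ) *
      ∑' d : ℤ, φ⁻¹ d * ((v : ℂ) * ((c + 1 : ℕ) : ℤ) * τ + d) ^ (-(2 : ℤ))‖ ≤
      ‖K‖ * (1 - ‖q‖)⁻¹ ^ 2 * ‖q‖ ^ (c + 1) := by
    intro c
    rw [hrow, norm_mul]
    rw [mul_assoc ‖K‖]
    refine mul_le_mul_of_nonneg_left ?_ (norm_nonneg _)
    have hQ : ‖q ^ (c + 1)‖ < 1 := by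
      rw [norm_pow]; exact pow_lt_one₀ (norm_nonneg _) hq (Nat.succ_ne_zero c)
    have hQle : ‖q ^ (c + 1)‖ ≤ ‖q‖ := by
      rw [norm_pow, pow_succ]
      exact mul_le_of_le_one_left (norm_nonneg _) (pow_le_one₀ (norm_nonneg _) hq.le)
    have hs : Summable fun n : ℕ ↦ (n : ℝ) * ‖q ^ (c + 1)‖ ^ n := by
      have := summable_pow_mul_geometric_of_norm_lt_one (R := ℝ) 1 (r := ‖q ^ (c + 1)‖)
        (by rwa [norm_norm])
      simpa using this
    calc ‖ψ ((c + 1 : ℕ) : ℤ) * ∑' n : ℕ, φ n * (n : ℂ) * (q ^ (c + 1)) ^ n‖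
        ≤ ∑' n : ℕ, (n : ℝ) * ‖q ^ (c + 1)‖ ^ n := by
          rw [norm_mul]
          refine (mul_le_of_le_one_left (norm_nonneg _) (ψ.norm_le_one _)).trans ?_
          refine tsum_of_norm_bounded hs.hasSum fun n ↦ ?_
          rw [norm_mul, norm_mul, norm_pow, Complex.norm_natCast]
          exact mul_le_mul_of_nonneg_right (mul_le_of_le_one_left (Nat.cast_nonneg _)
            (φ.norm_le_one _)) (pow_nonneg (norm_nonneg _) _)
      _ = ‖q ^ (c + 1)‖ / (1 - ‖q ^ (c + 1)‖) ^ 2 := tsum_coe_mul_geometric_of_norm_lt_one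
            (by rwa [norm_norm])
      _ ≤ (1 - ‖q‖)⁻¹ ^ 2 * ‖q‖ ^ (c + 1) := by
          rw [div_eq_mul_inv, mul_comm, ← inv_pow, norm_pow]
          refine mul_le_mul_of_nonneg_right ?_ (pow_nonneg (norm_nonneg _) _)
          have h1 : 0 < 1 - ‖q‖ := by linarith
          have h2 : 1 - ‖q‖ ≤ 1 - ‖q ^ (c + 1)‖ := by linarith
          rw [← norm_pow]
          exact pow_le_pow_left₀ (by positivity) ((inv_le_inv₀ (by linarith) h1).2 h2) 2
  have hnat : Summable fun c : ℕ ↦ ψ (c : ℤ) *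
      ∑' d : ℤ, φ⁻¹ d * ((v : ℂ) * (c : ℤ) * τ + d) ^ (-(2 : ℤ)) := by
    rw [← summable_nat_add_iff 1]
    refine Summable.of_norm_bounded (((summable_geometric_of_lt_one (norm_nonneg _) hq).mul_left
      (‖K‖ * (1 - ‖q‖)⁻¹ ^ 2)).comp_injective (add_left_injective 1)) fun c ↦ ?_
    exact hbound c
  refine summable_int_iff_summable_nat_and_neg.2 ⟨by simpa using hnat, ?_⟩
  refine hnat.congr fun c ↦ ?_
  have h := weightedRow_neg 2 ψ φ τ (by rw [hpar]; norm_num) (c : ℤ)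
  push_cast at h ⊢
  rw [h]

/-- **`S_2^{ψ,φ} = (uv)² ∑_{c ∈ ℤ} ψ(c) R_c`**, `R_c = ∑_{d ∈ ℤ} φ̄(d) (vcτ + d)^{-2}`, for `ψ ≠ 1`,
`φ` primitive and `ψ(-1)φ(-1) = 1` (level-one parts cancel; Eisenstein summation by rows).
[cite: DiamondShurman2005, §4.6, §4.8] -/
theorem twoCharTwo_eq_tsum_rows (hψ1 : ψ ≠ 1) (hφ : φ.IsPrimitive) (hpar : ψ (-1) * φ (-1) = 1) :
    twoCharTwo ψ φ τ = ((u * v : ℕ) : ℂ) ^ 2 *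
      ∑' c : ℤ, ψ c * ∑' d : ℤ, φ⁻¹ d * ((v : ℂ) * c * τ + d) ^ (-(2 : ℤ)) := by
  haveI : NeZero (u * v) := ⟨mul_ne_zero (NeZero.ne u) (NeZero.ne v)⟩
  have hT : ∀ (c₁ : ZMod u) (d₀ : ZMod (u * v)), Summable fun x : Fin 2 → ℤ ↦
      ((u * v : ℕ) : ℂ) ^ 2 * eisSummand 2 (tcLift c₁ d₀ - ((u * v : ℕ) : ℤ) • x) τ -
        eisSummand 2 x τ :=
    fun c₁ d₀ ↦ summable_weierstrassPDiv (NeZero.ne (u * v)) _ τ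
  have h1 : twoCharTwo ψ φ τ = ∑' x : Fin 2 → ℤ, ∑ c₁ : ZMod u, ∑ d₀ : ZMod (u * v),
      tcWeight ψ φ c₁ d₀ * (((u * v : ℕ) : ℂ) ^ 2 *
        eisSummand 2 (tcLift c₁ d₀ - ((u * v : ℕ) : ℤ) • x) τ - eisSummand 2 x τ) := by
    rw [twoCharTwo, Summable.tsum_finsetSum (fun c₁ _ ↦ summable_sum fun d₀ _ ↦ (hT c₁ d₀).mul_left _)]
    refine Finset.sum_congr rfl fun c₁ _ ↦ ?_
    rw [Summable.tsum_finsetSum (fun d₀ _ ↦ (hT c₁ d₀).mul_left _)]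
    refine Finset.sum_congr rfl fun d₀ _ ↦ ?_
    rw [pdivZ_tcVec, weierstrassPDiv, tsum_mul_left]
  rw [h1, tsum_congr (fun x ↦ sum_tcWeight_mul_summand ψ φ τ hψ1 x), tsum_mul_left]
  congr 1
  rw [← (finTwoArrowEquiv ℤ).symm.tsum_eq, ← (Equiv.neg (ℤ × ℤ)).tsum_eq]
  have hH := summable_sum_tcWeight_zpow ψ φ τ hψ1
  rw [show (fun p : ℤ × ℤ ↦ ∑ c₁ : ZMod u, ∑ d₀ : ZMod (u * v), tcWeight ψ φ c₁ d₀ *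
      eisSummand 2 (tcLift c₁ d₀ - ((u * v : ℕ) : ℤ) •
        (finTwoArrowEquiv ℤ).symm (Equiv.neg (ℤ × ℤ) p)) τ) =
      fun p : ℤ × ℤ ↦ ∑ c₁ : ZMod u, ∑ d₀ : ZMod (u * v), tcWeight ψ φ c₁ d₀ *
        ((v : ℂ) * ((p.1 * u + (c₁.val : ℤ) : ℤ) : ℂ) * τ +
          ((p.2 * (u * v : ℕ) + (d₀.val : ℤ) : ℤ) : ℂ)) ^ (-(2 : ℤ)) from ?_]
  · rw [hH.tsum_prod, tsum_congr (fun a ↦ tsum_sum_tcWeight_zpow_row ψ φ τ a)]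
    -- regroup `a` with `c₁`
    have hR := summable_weightedRowTwo ψ φ τ hφ hpar
    have hc₁ : ∀ c₁ : ZMod u, Summable fun a : ℤ ↦ ψ c₁ * ∑' d : ℤ, φ⁻¹ d *
        ((v : ℂ) * ((a * u + (c₁.val : ℤ) : ℤ) : ℂ) * τ + d) ^ (-(2 : ℤ)) := by
      intro c₁
      have h := hR.comp_injective (i := fun a : ℤ ↦ a * u + (c₁.val : ℤ))
        (fun a a' haa' ↦ by simpa [NeZero.ne u] using haa')
      refine h.congr fun a ↦ ?_
      simp only [Function.comp_apply, intCast_mul_add_val]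
    rw [Summable.tsum_finsetSum fun c₁ _ ↦ hc₁ c₁, tsum_int_eq_sum_zmod_tsum u hR]
    refine Finset.sum_congr rfl fun c₁ _ ↦ tsum_congr fun a ↦ ?_
    rw [intCast_mul_add_val]
  · funext p
    simp only [Equiv.neg_apply, finTwoArrowEquiv_symm_apply, Prod.fst_neg, Prod.snd_neg]
    refine Finset.sum_congr rfl fun c₁ _ ↦ Finset.sum_congr rfl fun d₀ _ ↦ ?_
    rw [eisSummand_tcLift_neg]

end Regroup

/-! ### The `q`-expansion -/

section QExpansion

/-- The constant `(uv)² · 2 v⁻² (-2πi)² W(φ̄)` in front of `∑ σ_1^{ψ,φ}(n) qⁿ`.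
[cite: DiamondShurman2005, Thm. 4.6.2] -/
def twoCharTwoConst (u : ℕ) {v : ℕ} [NeZero v] (φ : DirichletCharacter ℂ v) : ℂ :=
  ((u * v : ℕ) : ℂ) ^ 2 * (2 * (((v : ℂ) ^ 2)⁻¹ * (-2 * π * Complex.I) ^ 2 *
    gaussSum φ⁻¹ (ZMod.stdAddChar (N := v))))

variable {u v : ℕ} [NeZero u] [NeZero v] (ψ : DirichletCharacter ℂ u) (φ : DirichletCharacter ℂ v)

omit [NeZero u] in
/-- `ψ ≠ 1` forces `u ≠ 1`, so `ψ(0) = 0`. [folklore] -/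
theorem apply_zero_eq_zero_of_ne_one (hψ1 : ψ ≠ 1) : ψ 0 = 0 := by
  have hu1 : u ≠ 1 := fun h ↦ by subst h; exact hψ1 (DirichletCharacter.level_one ψ)
  haveI : Nontrivial (ZMod u) := ZMod.nontrivial_iff.mpr hu1
  exact ψ.map_nonunit not_isUnit_zero

/-- **The `q`-expansion of `S_2^{ψ,φ}`** (`ψ ≠ 1`, `φ` primitive, `ψ(-1)φ(-1) = 1`):
`S(τ) = (uv)² · 2 v⁻² (-2πi)² W(φ̄) ∑_{n ≥ 1} σ_1^{ψ,φ}(n) qⁿ`, `σ_1^{ψ,φ}(n) = ∑_{d∣n} ψ(n/d)φ(d)d`.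
[cite: DiamondShurman2005, Thm. 4.6.2, §4.8] -/
theorem twoCharTwo_eq_qExpansion (hψ1 : ψ ≠ 1) (hφ : φ.IsPrimitive) (hpar : ψ (-1) * φ (-1) = 1)
    (τ : ℍ) :
    twoCharTwo ψ φ τ = twoCharTwoConst u φ *
      ∑' n : ℕ+, (∑ d ∈ (n : ℕ).divisors, ψ (((n : ℕ) / d : ℕ)) * φ d * (d : ℂ)) *
        cexp (2 * π * Complex.I * τ) ^ (n : ℕ) := by
  have hφ' : φ⁻¹.IsPrimitive := Literature.NumberTheory.LFunctions.isPrimitive_inv φ hφ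
  have heven : Function.Even fun m : ℤ ↦
      ψ m * ∑' d : ℤ, φ⁻¹ d * ((v : ℂ) * m * τ + d) ^ (-(2 : ℤ)) := fun m ↦ by
    have h := weightedRow_neg 2 ψ φ τ (by rw [hpar]; norm_num) m
    push_cast at h ⊢
    simpa using h
  have hpos : ∀ m : ℕ+, (0 : ℤ) < ((m : ℕ) : ℤ) := fun m ↦ by exact_mod_cast m.pos
  have hq : ‖cexp (2 * π * Complex.I * τ)‖ < 1 := norm_exp_two_pi_I_lt_one τ
  have hinner : ∀ m : ℕ+,
      ψ (((m : ℕ) : ℤ)) * ∑' n : ℕ, φ n * (n : ℂ) *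
          cexp (2 * π * Complex.I * ((m : ℕ) : ℤ) * τ) ^ n =
        ∑' n : ℕ+, ψ (m : ℕ) * φ (n : ℕ) * ((n : ℕ) : ℂ) ^ 1 *
          cexp (2 * π * Complex.I * τ) ^ ((m : ℕ) * n : ℕ) := by
    intro m
    have h0 : (fun n : ℕ ↦ φ n * (n : ℂ) *
        cexp (2 * π * Complex.I * ((m : ℕ) : ℤ) * τ) ^ n) 0 = 0 := by
      simp only [Nat.cast_zero, mul_zero, zero_mul]
    rw [← tsum_pnat_eq_tsum_of_eq_zero (M := ℂ) h0, ← tsum_mul_left]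
    refine tsum_congr fun n ↦ ?_
    rw [pow_one, pow_mul, ← Complex.exp_nat_mul (2 * π * Complex.I * τ) m]
    have : (2 * π * Complex.I * (((m : ℕ) : ℤ) : ℂ) * τ) = (m : ℕ) * (2 * π * Complex.I * τ) := by
      push_cast; ring
    rw [this, Int.cast_natCast]
    ring
  have hmain : ∑' m : ℕ+, ψ (((m : ℕ) : ℤ)) *
      ∑' d : ℤ, φ⁻¹ d * ((v : ℂ) * ((m : ℕ) : ℤ) * τ + d) ^ (-(2 : ℤ)) =
      ((v : ℂ) ^ 2)⁻¹ * (-2 * π * Complex.I) ^ 2 * gaussSum φ⁻¹ (ZMod.stdAddChar (N := v)) *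
        ∑' n : ℕ+, (∑ d ∈ (n : ℕ).divisors, ψ (((n : ℕ) / d : ℕ)) * φ d * (d : ℂ)) *
          cexp (2 * π * Complex.I * τ) ^ (n : ℕ) := by
    rw [show (∑' m : ℕ+, ψ (((m : ℕ) : ℤ)) *
        ∑' d : ℤ, φ⁻¹ d * ((v : ℂ) * ((m : ℕ) : ℤ) * τ + d) ^ (-(2 : ℤ))) =
        ∑' m : ℕ+, ((v : ℂ) ^ 2)⁻¹ * (-2 * π * Complex.I) ^ 2 *
          gaussSum φ⁻¹ (ZMod.stdAddChar (N := v)) *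
          (ψ (((m : ℕ) : ℤ)) * ∑' n : ℕ, φ n * (n : ℂ) *
            cexp (2 * π * Complex.I * ((m : ℕ) : ℤ) * τ) ^ n)
        from tsum_congr fun m ↦ by
          rw [charRowTwo_pos φ⁻¹ τ hφ' (hpos m), inv_inv]; ring, tsum_mul_left]
    congr 1
    rw [tsum_congr hinner, ← (summable_prod_weight₂_mul_pow 1 hq (fun d ↦ ψ d) (fun d ↦ φ d)
      (fun d ↦ ψ.norm_le_one _) (fun d ↦ φ.norm_le_one _)).tsum_prod,
      tsum_prod_weight₂_mul_pow_eq_tsum_divisorSum 1 hq (fun d ↦ ψ d) (fun d ↦ φ d)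
        (fun d ↦ ψ.norm_le_one _) (fun d ↦ φ.norm_le_one _)]
    simp only [pow_one]
  rw [twoCharTwo_eq_tsum_rows ψ φ τ hψ1 hφ hpar, twoCharTwoConst,
    tsum_int_eq_zero_add_two_mul_tsum_pnat heven (summable_weightedRowTwo ψ φ τ hφ hpar),
    Int.cast_zero, apply_zero_eq_zero_of_ne_one ψ hψ1, zero_mul, zero_add, nsmul_eq_mul,
    Nat.cast_ofNat, hmain]
  ring

/-- **The `q`-expansion coefficients of the modular form `S_2^{ψ,φ} ∈ M_2(Γ₁(uv))`**:
`a₀ = 0` and `aₙ = twoCharTwoConst · σ_1^{ψ,φ}(n)` for `n ≥ 1`.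
[cite: DiamondShurman2005, Thm. 4.6.2, §4.8] -/
theorem qExpansion_coeff_twoCharTwoMF (hψ1 : ψ ≠ 1) (hφ : φ.IsPrimitive)
    (hpar : ψ (-1) * φ (-1) = 1) (n : ℕ) :
    (qExpansion 1 ⇑(twoCharTwoMF ψ φ)).coeff n =
      if n = 0 then 0 else twoCharTwoConst u φ * ∑ d ∈ n.divisors, ψ ((n / d : ℕ)) * φ d * (d : ℂ) := by
  set β : ℂ := twoCharTwoConst u φ with hβ
  set c : ℕ → ℂ := fun m ↦ if m = 0 then 0 else
    β * ∑ d ∈ m.divisors, ψ ((m / d : ℕ)) * φ d * (d : ℂ) with hc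
  suffices h : ∀ τ : ℍ, HasSum (fun m ↦ c m • Function.Periodic.qParam (1 : ℝ) τ ^ m)
      (twoCharTwoMF ψ φ τ) from
    (ModularFormClass.qExpansion_coeff_unique one_pos (by simp) h n).symm
  intro τ
  change HasSum (fun m ↦ c m * Function.Periodic.qParam (1 : ℝ) τ ^ m) (twoCharTwoMF ψ φ τ)
  have hq : ‖cexp (2 * π * Complex.I * τ)‖ < 1 := norm_exp_two_pi_I_lt_one τ
  have hS : Summable fun m : ℕ ↦ (∑ d ∈ (m + 1).divisors, ψ (((m + 1) / d : ℕ)) * φ d * (d : ℂ) ^ 1) *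
      cexp (2 * π * Complex.I * τ) ^ (m + 1) :=
    (summable_nat_add_iff 1).mpr
      (summable_divisorSum₂_mul_pow 1 hq (fun d ↦ ψ d) (fun d ↦ φ d)
        (fun d ↦ ψ.norm_le_one _) fun d ↦ φ.norm_le_one _)
  simp only [pow_one] at hS
  rw [← hasSum_nat_add_iff' 1]
  simp only [Nat.add_eq_zero_iff, one_ne_zero, and_false, ↓reduceIte, Finset.range_one,
    Finset.sum_singleton, c, Function.Periodic.qParam, Complex.ofReal_one, div_one,
    zero_mul, sub_zero]
  have hval : twoCharTwoMF ψ φ τ =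
      β * ∑' m : ℕ, (∑ d ∈ (m + 1).divisors, ψ (((m + 1) / d : ℕ)) * φ d * (d : ℂ)) *
        cexp (2 * π * Complex.I * τ) ^ (m + 1) := by
    change twoCharTwo ψ φ τ = _
    rw [twoCharTwo_eq_qExpansion ψ φ hψ1 hφ hpar τ, ← hβ,
      tsum_pnat_eq_tsum_succ (f := fun m : ℕ ↦
        (∑ d ∈ m.divisors, ψ ((m / d : ℕ)) * φ d * (d : ℂ)) * cexp (2 * π * Complex.I * τ) ^ m)]
  rw [hval]
  have h := hS.hasSum.mul_left β
  simp only [← mul_assoc] at h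
  exact h

end QExpansion

end Literature.NumberTheory.EllipticCurves.ModularForms
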